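import Mathlib
import HarnessLib
import Summits.QuantumFields.YangMills.Theses.GronwallGap

/-!
# `PathGapModulus` (stmt-QuantumFields-13946) — stub `stub_sumRuleLipschitz` of line `registered`

The registered stub `stub_sumRuleLipschitz` of the skeleton
`Cruxes/PathGapModulus/Lines/birth.lean` (crux `Summit.QuantumFields.YangMills.Theses.GronwallGap.PathGapModulus`,
route `GronwallGap`), proved AS STATED — and by pure logic, which is the finding recorded here:

the stub's hypothesis (the a-priori factor-`θ` capped stability of the volume-uniform clustering
rate over parameter distance `≤ δ`, i.e. the conclusion of the sibling stub `stub_aprioriStability`)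
chains along `[0,1]` to a UNIFORM rate floor: if one point of the path clusters at some rate then
every point clusters at one common rate `μ > 0` (`pathGap_noCollapse_of_stability`, using only that
the clustering predicate is antitone in the rate, `pathGap_clusterBound_antitone`). Choosing the cap
of the conclusion to be that floor, `M := μ`, and `K := 0`, every rate the capped log-Lipschitz
modulus ever asks for is `< min m μ ≤ μ`, which every point of the path already has — no transport,
no Feynman–Hellmann identity, no energy–action bound is needed. (If no point of the path clusters at
any rate the conclusion is vacuous.) Consequently the rate-capped crux carries no quantitative
content beyond the qualitative no-collapse statement; see the lead's evidence note on the item.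
-/

namespace Summit.QuantumFields.YangMills.Theorems

open Set

/-- The shape of the crux's clustering bound is ANTITONE in the rate: a bound
`|x S n| ≤ C e^{-m n}` (`S ≥ S₀`, `n ≤ S`) gives `|x S n| ≤ max C 0 · e^{-m' n}` for every
`m' ≤ m`. [folklore] -/
theorem pathGap_clusterBound_antitone {x : ℕ → ℕ → ℝ} {m m' : ℝ} (hm' : m' ≤ m)
    (h : ∃ C : ℝ, ∃ S₀ : ℕ, ∀ S : ℕ, S₀ ≤ S → ∀ n : ℕ, n ≤ S → |x S n| ≤ C * Real.exp (-(m * n))) :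
    ∃ C : ℝ, ∃ S₀ : ℕ, ∀ S : ℕ, S₀ ≤ S → ∀ n : ℕ, n ≤ S → |x S n| ≤ C * Real.exp (-(m' * n)) := by
  obtain ⟨C, S₀, hC⟩ := h
  refine ⟨max C 0, S₀, fun S hS n hn => (hC S hS n hn).trans ?_⟩
  have hn : (0 : ℝ) ≤ n := Nat.cast_nonneg n
  calc C * Real.exp (-(m * n)) ≤ max C 0 * Real.exp (-(m * n)) :=
        mul_le_mul_of_nonneg_right (le_max_left C 0) (Real.exp_pos _).le
    _ ≤ max C 0 * Real.exp (-(m' * n)) :=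
        mul_le_mul_of_nonneg_left (Real.exp_le_exp.mpr (by nlinarith)) (le_max_right C 0)

/-- **Chained capped stability gives a uniform rate floor.** For a predicate `P s m` ("rate `m`
is available at parameter `s`") antitone in the rate, the local factor-`θ` capped stability
`|s' − s| ≤ δ → P s m → P s' (θ · min m M)` on `[0,1]` implies: if some point `s₀ ∈ [0,1]`
carries some rate `m₀ > 0`, then EVERY point of `[0,1]` carries the common rate
`θ₁^(k+1) · min m₀ M`, where `θ₁ = min θ 1` and `k δ ≥ 1` (chain `k` steps of length `≤ δ`; the
cap is inactive after the first step). [folklore] -/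
theorem pathGap_noCollapse_of_stability {P : ℝ → ℝ → Prop}
    (hmono : ∀ s m m', 0 < m' → m' ≤ m → P s m → P s m')
    (h : ∃ δ M θ : ℝ, 0 < δ ∧ 0 < M ∧ 0 < θ ∧ ∀ s ∈ Icc (0 : ℝ) 1, ∀ s' ∈ Icc (0 : ℝ) 1,
      |s' - s| ≤ δ → ∀ m : ℝ, 0 < m → P s m → P s' (θ * min m M)) :
    (∃ s₀ ∈ Icc (0 : ℝ) 1, ∃ m₀ : ℝ, 0 < m₀ ∧ P s₀ m₀) →
      ∃ μ : ℝ, 0 < μ ∧ ∀ s ∈ Icc (0 : ℝ) 1, P s μ := by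
  rintro ⟨s₀, hs₀, m₀, hm₀, hP₀⟩
  obtain ⟨δ, M, θ, hδ, hM, hθ, hloc⟩ := h
  set θ₁ : ℝ := min θ 1 with hθ₁
  have hθ₁pos : 0 < θ₁ := lt_min hθ one_pos
  have hθ₁le : θ₁ ≤ 1 := min_le_right _ _
  have hθ₁leθ : θ₁ ≤ θ := min_le_left _ _
  have hmM : 0 < min m₀ M := lt_min hm₀ hM
  -- one step with the factor `θ₁` instead of `θ`
  have hstep : ∀ s ∈ Icc (0 : ℝ) 1, ∀ s' ∈ Icc (0 : ℝ) 1, |s' - s| ≤ δ → ∀ m : ℝ, 0 < m →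
      P s m → P s' (θ₁ * min m M) := by
    intro s hs s' hs' hd m hm hP
    have hmm : 0 < min m M := lt_min hm hM
    exact hmono s' _ _ (mul_pos hθ₁pos hmm)
      (mul_le_mul_of_nonneg_right hθ₁leθ hmm.le) (hloc s hs s' hs' hd m hm hP)
  -- the inductive claim
  have key : ∀ k : ℕ, ∀ s' ∈ Icc (0 : ℝ) 1, |s' - s₀| ≤ k * δ →
      P s' (θ₁ ^ (k + 1) * min m₀ M) := by
    intro k
    induction k with
    | zero =>
      intro s' hs' hd
      have hss : s' = s₀ := by
        have : |s' - s₀| ≤ 0 := by simpa using hd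
        have := abs_nonpos_iff.mp this
        linarith
      subst hss
      have h1 : θ₁ ^ (0 + 1) * min m₀ M ≤ m₀ :=
        calc θ₁ ^ (0 + 1) * min m₀ M ≤ 1 * min m₀ M := by
              gcongr; simpa using hθ₁le
          _ ≤ m₀ := by rw [one_mul]; exact min_le_left _ _
      exact hmono _ _ _ (mul_pos (pow_pos hθ₁pos _) hmM) h1 hP₀
    | succ k ih =>
      intro s' hs' hd
      -- intermediate point at fraction k/(k+1) of the way from s₀ to s'
      have hk1 : (0 : ℝ) < (k : ℝ) + 1 := by positivity
      set s'' : ℝ := s₀ + ((k : ℝ) / ((k : ℝ) + 1)) * (s' - s₀) with hs''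
      have hfrac0 : 0 ≤ (k : ℝ) / ((k : ℝ) + 1) := by positivity
      have hfrac1 : (k : ℝ) / ((k : ℝ) + 1) ≤ 1 := by
        rw [div_le_one hk1]; linarith
      have hs''mem : s'' ∈ Icc (0 : ℝ) 1 := by
        have e : s'' = (1 - (k : ℝ) / ((k : ℝ) + 1)) * s₀ + ((k : ℝ) / ((k : ℝ) + 1)) * s' := by
          rw [hs'']; ring
        rw [e]
        have ha : 0 ≤ 1 - (k : ℝ) / ((k : ℝ) + 1) := sub_nonneg.mpr hfrac1
        constructor
        · nlinarith [mul_nonneg ha hs₀.1, mul_nonneg hfrac0 hs'.1]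
        · nlinarith [mul_le_mul_of_nonneg_left hs₀.2 ha, mul_le_mul_of_nonneg_left hs'.2 hfrac0]
      have hd1 : |s'' - s₀| ≤ k * δ := by
        have e : s'' - s₀ = ((k : ℝ) / ((k : ℝ) + 1)) * (s' - s₀) := by rw [hs'']; ring
        rw [e, abs_mul, abs_of_nonneg hfrac0]
        have hd' : |s' - s₀| ≤ ((k : ℝ) + 1) * δ := by push_cast at hd; exact hd
        calc (k : ℝ) / ((k : ℝ) + 1) * |s' - s₀| ≤ (k : ℝ) / ((k : ℝ) + 1) * (((k : ℝ) + 1) * δ) := by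
              gcongr
          _ = k * δ := by field_simp
      have hd2 : |s' - s''| ≤ δ := by
        have e : s' - s'' = (1 / ((k : ℝ) + 1)) * (s' - s₀) := by rw [hs'']; field_simp; ring
        rw [e, abs_mul, abs_of_nonneg (by positivity : (0 : ℝ) ≤ 1 / ((k : ℝ) + 1))]
        have hd' : |s' - s₀| ≤ ((k : ℝ) + 1) * δ := by push_cast at hd; exact hd
        calc 1 / ((k : ℝ) + 1) * |s' - s₀| ≤ 1 / ((k : ℝ) + 1) * (((k : ℝ) + 1) * δ) := by gcongr
          _ = δ := by field_simp
      have hP'' : P s'' (θ₁ ^ (k + 1) * min m₀ M) := ih s'' hs''mem hd1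
      have hrpos : 0 < θ₁ ^ (k + 1) * min m₀ M := mul_pos (pow_pos hθ₁pos _) hmM
      have hrM : θ₁ ^ (k + 1) * min m₀ M ≤ M :=
        calc θ₁ ^ (k + 1) * min m₀ M ≤ 1 * min m₀ M := by
              gcongr; exact pow_le_one₀ hθ₁pos.le hθ₁le
          _ ≤ M := by rw [one_mul]; exact min_le_right _ _
      have h3 := hstep s'' hs''mem s' hs' hd2 _ hrpos hP''
      rw [min_eq_left hrM] at h3
      have e : θ₁ ^ (k + 1 + 1) * min m₀ M = θ₁ * (θ₁ ^ (k + 1) * min m₀ M) := by ring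
      rw [e]
      exact h3
  -- conclude with `k` steps, `k δ ≥ 1`
  obtain ⟨k, hk⟩ : ∃ k : ℕ, 1 / δ ≤ k := exists_nat_ge _
  refine ⟨θ₁ ^ (k + 1) * min m₀ M, mul_pos (pow_pos hθ₁pos _) hmM, fun s hs => key k s hs ?_⟩
  have h1 : 1 ≤ (k : ℝ) * δ := by
    have := (div_le_iff₀ hδ).mp hk
    linarith
  have h2 : |s - s₀| ≤ 1 := by
    rw [abs_le]; constructor <;> linarith [hs.1, hs.2, hs₀.1, hs₀.2]
  linarith

/-- **Stub `stub_sumRuleLipschitz` of line `registered` (crux `PathGapModulus`,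
stmt-QuantumFields-13946), as registered.** Given the a-priori capped stability of the
volume-uniform clustering rate along an admissible analytic-pressure weight path (hypothesis), the
transport is capped log-Lipschitz over parameter distance `≤ δ` — in fact with `δ = 1`, `K = 0`
and the cap `M := μ`, the uniform rate floor of the path delivered by
`pathGap_noCollapse_of_stability` (case: some point clusters at some rate; otherwise the
conclusion is vacuous): every requested rate `m' < min m μ` is at most `μ`, which every point of
the path has, and the clustering predicate is antitone in the rate
(`pathGap_clusterBound_antitone`). No spectral / sum-rule input is used. [folklore] -/
theorem stub_sumRuleLipschitz :
    ∀ (G : Type) [Group G] [TopologicalSpace G] [IsTopologicalGroup G] [CompactSpace G],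
      Literature.MathematicalPhysics.QuantumFieldTheory.IsCompactSimpleLieGroup G →
      letI : MeasurableSpace G := borel G; haveI : BorelSpace G := ⟨rfl⟩;
      let UCw : (ℝ → G → ℝ) → ℝ → ℝ → Prop := fun w s m => ∀ A B : Literature.MathematicalPhysics.QuantumFieldTheory.YMSpecies G, ∃ C : ℝ, ∃ S₀ : ℕ, ∀ S : ℕ, S₀ ≤ S → ∀ n : ℕ, n ≤ S → |(∫ U, A.F (Literature.MathematicalPhysics.QuantumLattice.torusLift (2 * S + 1) U) * B.F (Literature.MathematicalPhysics.QuantumLattice.configShift (-Pi.single 0 (n : ℤ)) (Literature.MathematicalPhysics.QuantumLattice.torusLift (2 * S + 1) U)) ∂(Literature.MathematicalPhysics.QuantumLattice.groupHeatKernelMeasure (d := 4) (L := 2 * S + 1) w s)) - (∫ U, A.F (Literature.MathematicalPhysics.QuantumLattice.torusLift (2 * S + 1) U) ∂(Literature.MathematicalPhysics.QuantumLattice.groupHeatKernelMeasure (d := 4) (L := 2 * S + 1) w s)) * (∫ U, B.F (Literature.MathematicalPhysics.QuantumLattice.torusLift (2 * S + 1) U) ∂(Literature.MathematicalPhysics.QuantumLattice.groupHeatKernelMeasure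 (d := 4) (L := 2 * S + 1) w s))| ≤ C * Real.exp (-(m * n));
      let Pseq : (G → ℝ) → ℕ → ℝ := fun v L => (((L + 1 : ℕ) : ℝ) ^ 4)⁻¹ * Real.log (((MeasureTheory.Measure.pi fun _ : Literature.MathematicalPhysics.QuantumFieldTheory.Edge 4 (L + 1) => Literature.MathematicalPhysics.QuantumFieldTheory.haarProbability G).withDensity (fun U : Literature.MathematicalPhysics.QuantumFieldTheory.GaugeConfig 4 (L + 1) G => ENNReal.ofReal (Literature.MathematicalPhysics.QuantumLattice.groupHeatKernelWeight (fun _ : ℝ => v) 0 U))) Set.univ).toReal;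
      let AnP : (G → ℝ) → Prop := fun v => ∀ φ : G → ℝ, Continuous φ → (∀ g h : G, φ (h * g * h⁻¹) = φ g) → ∃ p : ℝ → ℝ, (∀ t : ℝ, Filter.Tendsto (fun L : ℕ => Pseq (fun g => v g * Real.exp (t * φ g)) L) Filter.atTop (nhds (p t))) ∧ AnalyticAt ℝ p 0;
      let Adm : (ℝ → G → ℝ) → Prop := fun w => (∀ s ∈ Set.Icc (0 : ℝ) 1, Continuous (w s) ∧ (∀ g : G, 0 < w s g) ∧ (∀ g h : G, w s (h * g * h⁻¹) = w s g) ∧ (∀ g : G, w s g⁻¹ = w s g) ∧ (∀ (n : ℕ) (x : Fin n → G) (c : Fin n → ℂ), 0 ≤ (∑ i, ∑ j, (starRingEnd ℂ) (c i) * c j * ((w s ((x i)⁻¹ * x j) : ℝ) : ℂ)).re)) ∧ ∃ Λ : ℝ, ∀ s ∈ Set.Icc (0 : ℝ) 1, ∀ s' ∈ Set.Icc (0 : ℝ) 1, ∀ g : G, |Real.log (w s g) - Real.log (w s' g)| ≤ Λ * |s - s'|;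
      ∀ w : ℝ → G → ℝ, Adm w → (∀ s ∈ Set.Icc (0 : ℝ) 1, AnP (w s)) →
        (∃ δ M θ : ℝ, 0 < δ ∧ 0 < M ∧ 0 < θ ∧ ∀ s ∈ Set.Icc (0 : ℝ) 1, ∀ s' ∈ Set.Icc (0 : ℝ) 1, |s' - s| ≤ δ → ∀ m : ℝ, 0 < m → UCw w s m → UCw w s' (θ * min m M)) →
        ∃ δ K M : ℝ, 0 < δ ∧ 0 ≤ K ∧ 0 < M ∧ ∀ s ∈ Set.Icc (0 : ℝ) 1, ∀ s' ∈ Set.Icc (0 : ℝ) 1, |s' - s| ≤ δ → ∀ m : ℝ, 0 < m → UCw w s m → ∀ m' : ℝ, 0 < m' → m' < min m M * Real.exp (-(K * |s' - s|)) → UCw w s' m' := by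
  intro G _ _ _ _ hG UCw Pseq AnP Adm w hAdm hAn hstab
  have hmono : ∀ s m m', 0 < m' → m' ≤ m → UCw w s m → UCw w s m' :=
    fun s m m' _ hle hU A B => pathGap_clusterBound_antitone hle (hU A B)
  by_cases hex : ∃ s₀ ∈ Set.Icc (0 : ℝ) 1, ∃ m₀ : ℝ, 0 < m₀ ∧ UCw w s₀ m₀
  · obtain ⟨μ, hμ, hall⟩ := pathGap_noCollapse_of_stability hmono hstab hex
    refine ⟨1, 0, μ, one_pos, le_rfl, hμ, ?_⟩
    intro s hs s' hs' _ m hm _ m' hm' hlt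
    have hle : m' ≤ μ := by
      have h1 : min m μ * Real.exp (-(0 * |s' - s|)) = min m μ := by simp
      rw [h1] at hlt
      exact (hlt.le.trans (min_le_right _ _))
    exact hmono s' μ m' hm' hle (hall s' hs')
  · refine ⟨1, 0, 1, one_pos, le_rfl, one_pos, ?_⟩
    intro s hs s' hs' _ m hm hP m' hm' hlt
    exact (hex ⟨s, hs, m, hm, hP⟩).elim

end Summit.QuantumFields.YangMills.Theorems
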